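import Mathlib
import Summits.MatrixMultiplication.MatrixMultiplication.Theorems.SubgroupIdentityDesigns.Negative.TorusBudget
import Summits.MatrixMultiplication.MatrixMultiplication.Theorems.SubgroupIdentityDesigns.Negative.ProjectiveLine

/-!
# The two-`p`-member volume law (all `p`)

Route `LevelGradedCohnUmans`, crux `SubgroupIdentityDesigns`, the `(m,k) = (2,1)` cell.

Torus budget (`TorusBudget.torus_budget`: TPP + `U⁺ ≤ H₁` + diagonal `D₁ ≤ H₁`, `D₂ ≤ H₂` +
upper-triangular `S' ≤ H₃` + level-`1` identity design ⇒ `|D₁||D₂||S'| ≤ p - 1`) combined with the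
projective-line bound (`ProjectiveLine.card_le_succ_mul_card_upper`: `|H₃| ≤ (p+1)|H₃ ∩ B⁺|`):
`|D₁|·|D₂|·|H₃| ≤ (p-1)(p+1)` (`volume_law_two_pMembers`).  For a FRAME (`|H₁| ≤ p|D₁|`,
`|H₂| ≤ p|D₂|`; e.g. `H₁ = U⁺T₁ ≤ B⁺`, `H₂ = U⁻T₂ ≤ B⁻`, `H₃` arbitrary) this is
`|H₁||H₂||H₃| ≤ p²(p²-1) ≤ 1 + p³ + (p-2)(p+1)³`, the level-one floor: NO level-one witness of the
crux inequality for any prime `p ≥ 3` and any `0 < ε ≤ 1` (`no_levelOne_witness_of_frame`).  This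
is the all-`p` proof of what the `p = 7, 11` census saw (the torus budget decided 100 % of the
two-`p`-member triples above the floor in the placement `(U⁺T₁, U⁻T₂, S)`).

VALUE = THEOREM (all `p`), NOT summit progress; the crux item stmt-MatrixMultiplication-14079 is
untouched and remains open (the placement `(U⁺T₁, S, U⁻T₂)`, one-`p`-member and `p`-free triples are
not covered here).
-/

set_option linter.dupNamespace false

noncomputable section

open scoped BigOperators Classical

open Summit.MatrixMultiplication.MatrixMultiplication.Theorems.LieRankDesigns.Negative
  (GLm Mat fourierFn budget)
open Summit.MatrixMultiplication.MatrixMultiplication.Theorems.LevelOneGL2Designs.Negative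
  (levelSubmodule fourierFn_mem_levelSubmodule)

namespace Summit.MatrixMultiplication.MatrixMultiplication.Theorems.SubgroupIdentityDesigns.Negative

section TwoPMemberLaw

open Literature.Barriers.MatrixMultiplication (SubgroupTPP)

variable {p : ℕ} [hp : Fact p.Prime]

/-- **Two-`p`-member volume law** (all `p`): TPP + `U⁺ ≤ H₁` + diagonal `D₁ ≤ H₁`, `D₂ ≤ H₂` +
a level-`1` identity design ⇒ `|D₁|·|D₂|·|H₃| ≤ (p-1)(p+1)`. -/
theorem volume_law_two_pMembers {H₁ H₂ H₃ : Subgroup (GLm p 2)} (htpp : SubgroupTPP H₁ H₂ H₃)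
    (hU : ∀ u : GLm p 2, (u : Mat p 2) 1 0 = 0 → (u : Mat p 2) 0 0 = 1 → (u : Mat p 2) 1 1 = 1 →
      u ∈ H₁)
    {D₁ D₂ : Subgroup (GLm p 2)} (hD₁ : D₁ ≤ H₁) (hD₂ : D₂ ≤ H₂)
    (hd₁ : ∀ d ∈ D₁, (d : Mat p 2) 0 1 = 0 ∧ (d : Mat p 2) 1 0 = 0)
    (hd₂ : ∀ d ∈ D₂, (d : Mat p 2) 0 1 = 0 ∧ (d : Mat p 2) 1 0 = 0)
    (hdesign : ∃ f ∈ levelSubmodule p 2 1, f 1 = 1 ∧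
      ∀ a ∈ H₁, ∀ b ∈ H₂, ∀ c ∈ H₃, a * b * c ≠ 1 → f (a * b * c) = 0) :
    Nat.card D₁ * Nat.card D₂ * Nat.card H₃ ≤ (p - 1) * (p + 1) := by
  obtain ⟨S', hS'le, hs', hS'B⟩ := exists_upper_part H₃
  have h1 := torus_budget htpp hU hD₁ hD₂ hS'le hd₁ hd₂ hs' hdesign
  have h2 := card_le_succ_mul_card_upper H₃ S' hS'B
  calc Nat.card D₁ * Nat.card D₂ * Nat.card H₃
      ≤ Nat.card D₁ * Nat.card D₂ * ((p + 1) * Nat.card S') := Nat.mul_le_mul_left _ h2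
    _ = Nat.card D₁ * Nat.card D₂ * Nat.card S' * (p + 1) := by ring
    _ ≤ (p - 1) * (p + 1) := Nat.mul_le_mul_right _ h1

/-- **No level-one witness on a two-`p`-member frame** (all primes `p ≥ 3`, all `0 < ε ≤ 1`):
if `U⁺ ≤ H₁`, `D₁ ≤ H₁`, `D₂ ≤ H₂` are diagonal with `|H₁| ≤ p|D₁|`, `|H₂| ≤ p|D₂|` (e.g.
`H₁ = U⁺T₁ ≤ B⁺`, `H₂ = U⁻T₂ ≤ B⁻`), `H₃` is arbitrary, the triple satisfies the subgroup TPP and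
carries a level-`1` identity design, then `|H₁||H₂||H₃| ≤ p²(p²-1)` lies below the level-one floor
and the crux inequality `budget p 2 1 (2+ε) < V^{(2+ε)/3}` fails. -/
theorem no_levelOne_witness_of_frame (hp3 : 3 ≤ p) {ε : ℝ} (hε : 0 < ε) (hε1 : ε ≤ 1)
    {H₁ H₂ H₃ : Subgroup (GLm p 2)} (htpp : SubgroupTPP H₁ H₂ H₃)
    (hU : ∀ u : GLm p 2, (u : Mat p 2) 1 0 = 0 → (u : Mat p 2) 0 0 = 1 → (u : Mat p 2) 1 1 = 1 →
      u ∈ H₁)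
    {D₁ D₂ : Subgroup (GLm p 2)} (hD₁ : D₁ ≤ H₁) (hD₂ : D₂ ≤ H₂)
    (hd₁ : ∀ d ∈ D₁, (d : Mat p 2) 0 1 = 0 ∧ (d : Mat p 2) 1 0 = 0)
    (hd₂ : ∀ d ∈ D₂, (d : Mat p 2) 0 1 = 0 ∧ (d : Mat p 2) 1 0 = 0)
    (hK₁ : Nat.card H₁ ≤ p * Nat.card D₁) (hK₂ : Nat.card H₂ ≤ p * Nat.card D₂)
    (hdesign : ∃ c : Mat p 2 → ℂ, (∀ M, 1 < M.rank → c M = 0) ∧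
      (∑ M, c M * ZMod.stdAddChar (Matrix.trace (M * ((1 : GLm p 2) : Mat p 2)))) = 1 ∧
      ∀ a ∈ H₁, ∀ b ∈ H₂, ∀ g ∈ H₃, a * b * g ≠ 1 →
        (∑ M, c M *
          ZMod.stdAddChar (Matrix.trace (M * ((a * b * g : GLm p 2) : Mat p 2)))) = 0) :
    ¬ budget p 2 1 (2 + ε) <
      ((Nat.card H₁ * Nat.card H₂ * Nat.card H₃ : ℕ) : ℝ) ^ ((2 + ε) / 3) := by
  obtain ⟨c, hc, hc1, hc0⟩ := hdesign
  have h := volume_law_two_pMembers htpp hU hD₁ hD₂ hd₁ hd₂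
    ⟨fourierFn c, fourierFn_mem_levelSubmodule hc, hc1, fun a ha b hb g hg hne =>
      hc0 a ha b hb g hg hne⟩
  refine no_levelOne_witness_of_volume_le_nat (by linarith) hε1 ?_
  calc Nat.card H₁ * Nat.card H₂ * Nat.card H₃
      ≤ p * Nat.card D₁ * (p * Nat.card D₂) * Nat.card H₃ :=
        Nat.mul_le_mul (Nat.mul_le_mul hK₁ hK₂) le_rfl
    _ = p * p * (Nat.card D₁ * Nat.card D₂ * Nat.card H₃) := by ring
    _ ≤ p * p * ((p - 1) * (p + 1)) := Nat.mul_le_mul_left _ h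
    _ ≤ 1 + p ^ 3 + (p - 2) * (p + 1) ^ 3 := sq_mul_pred_mul_succ_le_floor hp3

end TwoPMemberLaw

end Summit.MatrixMultiplication.MatrixMultiplication.Theorems.SubgroupIdentityDesigns.Negative

end
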